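import Literature.MathematicalPhysics.KineticTheory.HardSphereEulerProofs
import HarnessLib

/-!
# Crux `FluxClosure` (stmt-AtomisticToContinuum-9902, route BoxDissipativeWeakStrong), line `registered`:
# disjointness of the lattice-shifted cubes (sub-goal S2 of the entropy line for the kinetic stub K)

Support file (`--supports stmt-AtomisticToContinuum-9902`) for the crux
`Summit.AtomisticToContinuum.HydrodynamicLimit.Theses.BoxDissipativeWeakStrong.FluxClosure`: the registered sub-goal
S2 `boxSet_disjoint_of_shift`. The exponential-moment step of the entropy line writes the torus integral of a box
functional as an average over shifts `x ∈ 𝕋³` of sums over the cubic lattice `x + k/m`, `k ∈ {0,…,m-1}³`, and needs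
the open cubes of side `l ≤ 1/m` centred at the lattice points to be pairwise disjoint, so that box functionals of
different lattice cubes depend on disjoint sets of particles.

* `boxSet_disjoint_of_shift` — if `k ≠ k'` pick a coordinate `i` with `k i ≠ k' i`; a point `y` in both cubes has
  `‖y i - (x i + k i/m)‖ < l/2` and `‖y i - (x i + k' i/m)‖ < l/2`, so `‖(k i/m : 𝕋) - (k' i/m : 𝕋)‖ < l ≤ 1/m` by the
  triangle inequality in `UnitAddCircle`, contradicting the separation `‖a/m - b/m‖ ≥ 1/m` of distinct `m`-division
  points of the circle (`inv_le_norm_sub_div_unitAddCircle`, `Literature/MathematicalPhysics/KineticTheory`).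

No definitions, no new facts; Mathlib and the `HardSphereEulerProofs` torus-grid lemma only.
-/

noncomputable section

namespace Summit.AtomisticToContinuum.HydrodynamicLimit.Theorems
namespace FluxClosureEnt

open scoped BigOperators Topology Classical
open Set Function
open Literature.MathematicalPhysics.KineticTheory

/-- **S2: the lattice-shifted cubes are pairwise disjoint.** For `0 < m`, `0 < l ≤ 1/m`, a shift `x ∈ 𝕋³` and two
distinct lattice indices `k ≠ k' ∈ {0,…,m-1}³`, the open sup-norm cubes of side `l` centred at `x + k/m` and
`x + k'/m` do not meet: along a coordinate `i` with `k i ≠ k' i` the two centres are `≥ 1/m ≥ l` apart on the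
circle, while a common point would put them `< l/2 + l/2` apart. -/
theorem boxSet_disjoint_of_shift : ∀ (m : ℕ), 0 < m → ∀ (l : ℝ), 0 < l → l ≤ 1 / (m : ℝ) → ∀ (x : T3) (k k' : Fin 3 → Fin m), k ≠ k' → Disjoint {y : T3 | ∀ i, ‖y i - (x + fun i => (((((k i : ℕ) : ℝ) / (m : ℝ)) : ℝ) : UnitAddCircle)) i‖ < l / 2} {y : T3 | ∀ i, ‖y i - (x + fun i => (((((k' i : ℕ) : ℝ) / (m : ℝ)) : ℝ) : UnitAddCircle)) i‖ < l / 2} := by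
  intro m hm l _hl hlm x k k' hkk'
  obtain ⟨i, hi⟩ := Function.ne_iff.mp hkk'
  rw [Set.disjoint_left]
  intro y hy hy'
  -- the two centre coordinates along `i`
  have h1 : ‖y i - (x i + (((((k i : ℕ) : ℝ) / (m : ℝ)) : ℝ) : UnitAddCircle))‖ < l / 2 := hy i
  have h2 : ‖y i - (x i + (((((k' i : ℕ) : ℝ) / (m : ℝ)) : ℝ) : UnitAddCircle))‖ < l / 2 := hy' i
  -- distinct `m`-division points of the circle are `≥ 1/m` apart
  have hsep : (m : ℝ)⁻¹ ≤ ‖(((((k i : ℕ) : ℝ) / (m : ℝ)) : ℝ) : UnitAddCircle)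
      - (((((k' i : ℕ) : ℝ) / (m : ℝ)) : ℝ) : UnitAddCircle)‖ :=
    inv_le_norm_sub_div_unitAddCircle hm (k i).isLt (k' i).isLt (fun h => hi (Fin.ext h))
  -- triangle inequality through the common point `y i`
  have heq : (((((k i : ℕ) : ℝ) / (m : ℝ)) : ℝ) : UnitAddCircle) - (((((k' i : ℕ) : ℝ) / (m : ℝ)) : ℝ) : UnitAddCircle)
      = (y i - (x i + (((((k' i : ℕ) : ℝ) / (m : ℝ)) : ℝ) : UnitAddCircle)))
        - (y i - (x i + (((((k i : ℕ) : ℝ) / (m : ℝ)) : ℝ) : UnitAddCircle))) := by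
    abel
  have hlt : ‖(((((k i : ℕ) : ℝ) / (m : ℝ)) : ℝ) : UnitAddCircle)
      - (((((k' i : ℕ) : ℝ) / (m : ℝ)) : ℝ) : UnitAddCircle)‖ < l := by
    rw [heq]
    calc ‖(y i - (x i + (((((k' i : ℕ) : ℝ) / (m : ℝ)) : ℝ) : UnitAddCircle)))
          - (y i - (x i + (((((k i : ℕ) : ℝ) / (m : ℝ)) : ℝ) : UnitAddCircle)))‖
        ≤ ‖y i - (x i + (((((k' i : ℕ) : ℝ) / (m : ℝ)) : ℝ) : UnitAddCircle))‖
          + ‖y i - (x i + (((((k i : ℕ) : ℝ) / (m : ℝ)) : ℝ) : UnitAddCircle))‖ := norm_sub_le _ _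
      _ < l / 2 + l / 2 := add_lt_add h2 h1
      _ = l := by ring
  rw [one_div] at hlm
  linarith

end FluxClosureEnt
end Summit.AtomisticToContinuum.HydrodynamicLimit.Theorems

end
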